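import Mathlib.Analysis.Calculus.ContDiff.Operations
import Mathlib.Analysis.SpecialFunctions.Sqrt
import Mathlib.Analysis.Normed.Operator.ContinuousLinearMap
import Mathlib.LinearAlgebra.LinearIndependent.Lemmas
import Mathlib.LinearAlgebra.Dimension.Finrank
import Mathlib.LinearAlgebra.FiniteDimensional.Lemmas
import HarnessLib

/-!
# Smooth Gram–Schmidt with respect to a smoothly varying positive definite bilinear form

Topic `Literature/Analysis/InnerProduct` (support for the fact seat
`provefact-Literature.Geometry.Lorentzian.hawkingEllis_locallyUnique_vacuumDevelopment`: smooth
orthonormal spatial frames for a smoothly varying Riemannian slice metric, used to write a linear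
wave equation as a symmetric hyperbolic system with `A⁰ = 1`). Everything here is **proved**; no
definitions of `Prop` type.

The tree's `Geometry/Riemannian/MeanConvexSmoothGramSchmidt.lean`
(`exists_smooth_gramSchmidt_coeff`) and `Analysis/InnerProduct/SmoothGramSchmidt.lean` treat a
*fixed* inner product and smoothly varying vectors. Here the inner product varies too:
`B : P → (V →L V →L ℝ)`, `C^∞` on a set `U`, symmetric and positive definite at every point of
`U` (no inner product structure on `V` is used). The explicit recursion of the process gives:

* `exists_smooth_gramSchmidt_coeff_bilin` — for vector fields `v₀, …, v_{k-1} : P → V`, `C^∞` on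
  `U` and linearly independent at every point of `U`, there are `C^∞` coefficient functions
  `c l j : P → ℝ` on `U`, lower triangular with positive diagonal, such that the fields
  `u_l = ∑ⱼ c l j • vⱼ`, `l < k`, are `B_p`-orthonormal at every `p ∈ U`:
  `B_p(u_l(p), u_{l'}(p)) = δ_{ll'}`;
* `sum_bilin_smul_eq_self_of_orthonormal` — resolution of the identity: if `k = dim V` then
  `x = ∑_l B_p(u_l, x) u_l` for every `x`.

Warner, *Foundations of Differentiable Manifolds and Lie Groups*, GTM 94 (1983), 4.10, p. 149
("apply the usual Gram–Schmidt procedure … simultaneously at all points of `U`").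

## References

* F. W. Warner, *Foundations of Differentiable Manifolds and Lie Groups*, GTM 94 (1983), 4.10,
  p. 149. [WarnerGTM94]
-/

noncomputable section

open Set Function Finset
open scoped ContDiff

namespace Literature.Analysis.InnerProduct

variable {P V : Type*} [NormedAddCommGroup P] [NormedSpace ℝ P] [NormedAddCommGroup V]
  [NormedSpace ℝ V]

/-- **Smooth Gram–Schmidt with triangular coefficients, for a varying positive definite symmetric
bilinear form.** Let `B : P → (V →L V →L ℝ)` be `C^∞` on `U`, symmetric and positive definite at
the points of `U`, and let `v j : P → V` (`j < k`) be `C^∞` on `U` and linearly independent at every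
point of `U`. Then there are coefficient functions `c l j : P → ℝ`, `C^∞` on `U`, with `c l j = 0`
for `j > l` and `c l l > 0` on `U` (`l < k`), such that at every `p ∈ U` the vectors
`u_l(p) = ∑_{j < k} c l j p • v j p`, `l < k`, are `B_p`-orthonormal. [cite: WarnerGTM94, 4.10, p. 149] -/
theorem exists_smooth_gramSchmidt_coeff_bilin {U : Set P} (B : P → V →L[ℝ] V →L[ℝ] ℝ)
    (hB : ContDiffOn ℝ ∞ B U) (hBs : ∀ p ∈ U, ∀ x y, B p x y = B p y x)
    (hBpos : ∀ p ∈ U, ∀ x, x ≠ 0 → 0 < B p x x) (k : ℕ) (v : ℕ → P → V)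
    (hv : ∀ j < k, ContDiffOn ℝ ∞ (v j) U)
    (hli : ∀ p ∈ U, LinearIndependent ℝ (fun j : Fin k => v j p)) :
    ∃ c : ℕ → ℕ → P → ℝ, (∀ l j, ContDiffOn ℝ ∞ (c l j) U) ∧ (∀ l j, l < j → c l j = 0) ∧
      (∀ p ∈ U, ∀ l < k, 0 < c l l p) ∧
      ∀ p ∈ U, ∀ l < k, ∀ l' < k,
        B p (∑ j ∈ range k, c l j p • v j p) (∑ j ∈ range k, c l' j p • v j p) =
          if l = l' then 1 else 0 := by
  classical
  -- induction on the number `i` of rows already built (rows `≥ i` are zero)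
  suffices H : ∀ i ≤ k, ∃ c : ℕ → ℕ → P → ℝ, (∀ l j, ContDiffOn ℝ ∞ (c l j) U) ∧
      (∀ l j, l < j → c l j = 0) ∧ (∀ l, i ≤ l → ∀ j, c l j = 0) ∧
      (∀ p ∈ U, ∀ l < i, 0 < c l l p) ∧
      ∀ p ∈ U, ∀ l < i, ∀ l' < i,
        B p (∑ j ∈ range k, c l j p • v j p) (∑ j ∈ range k, c l' j p • v j p) =
          if l = l' then 1 else 0 by
    obtain ⟨c, hc, htri, -, hdiag, horth⟩ := H k le_rfl
    exact ⟨c, hc, htri, hdiag, horth⟩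
  intro i
  induction i with
  | zero =>
    intro _
    exact ⟨fun _ _ _ ↦ 0, fun l j ↦ contDiffOn_const, fun l j _ ↦ rfl, fun l _ j ↦ rfl,
      fun p _ l hl ↦ absurd hl (Nat.not_lt_zero l), fun p _ l hl ↦ absurd hl (Nat.not_lt_zero l)⟩
  | succ i ih =>
    intro hik
    have hi : i < k := Nat.lt_of_succ_le hik
    obtain ⟨c, hc, htri, hzero, hdiag, horth⟩ := ih hi.le
    -- the rows built so far, as vector fields
    set u : ℕ → P → V := fun l p ↦ ∑ j ∈ range k, c l j p • v j p with hu
    have husm : ∀ l, ContDiffOn ℝ ∞ (u l) U := fun l ↦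
      ContDiffOn.sum fun j hj ↦ (hc l j).smul (hv j (mem_range.1 hj))
    -- smoothness of pairings `p ↦ B p (f p) (g p)`
    have hpair : ∀ {f g : P → V}, ContDiffOn ℝ ∞ f U → ContDiffOn ℝ ∞ g U →
        ContDiffOn ℝ ∞ (fun p ↦ B p (f p) (g p)) U := fun hf hg ↦ (hB.clm_apply hf).clm_apply hg
    -- `u l p ∈ span {v j p | j < i}` for `l < i`
    have huspan : ∀ p, ∀ l < i,
        u l p ∈ Submodule.span ℝ ((fun j : Fin k ↦ v j p) '' {j | j.val < i}) := by
      intro p l hl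
      refine Submodule.sum_mem _ fun j hj ↦ ?_
      by_cases hjl : l < j
      · rw [htri l j hjl]; simp
      · refine Submodule.smul_mem _ _ (Submodule.subset_span ⟨⟨j, mem_range.1 hj⟩, ?_, rfl⟩)
        show j < i
        omega
    -- the new vector `w = v i - ∑_{l < i} B(u l, v i) u l`, smooth and nonvanishing on `U`
    set w : P → V := fun p ↦ v i p - ∑ l ∈ range i, B p (u l p) (v i p) • u l p with hw
    have hwsm : ContDiffOn ℝ ∞ w U :=
      (hv i hi).sub (ContDiffOn.sum fun l _ ↦ (hpair (husm l) (hv i hi)).smul (husm l))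
    have hwne : ∀ p ∈ U, w p ≠ 0 := by
      intro p hp h0
      have hmem : v i p ∈ Submodule.span ℝ ((fun j : Fin k ↦ v j p) '' {j | j.val < i}) := by
        have : v i p = ∑ l ∈ range i, B p (u l p) (v i p) • u l p := by
          have := h0; rw [hw] at this; exact sub_eq_zero.1 this
        rw [this]
        exact Submodule.sum_mem _ fun l hl ↦ Submodule.smul_mem _ _ (huspan p l (mem_range.1 hl))
      have hnot := (hli p hp).notMem_span_image (s := {j : Fin k | j.val < i}) (x := ⟨i, hi⟩)
        (by simp)
      exact hnot hmem
    -- the `B`-norm of `w`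
    set r : P → ℝ := fun p ↦ Real.sqrt (B p (w p) (w p)) with hr
    have hBw_pos : ∀ p ∈ U, 0 < B p (w p) (w p) := fun p hp ↦ hBpos p hp _ (hwne p hp)
    have hr_pos : ∀ p ∈ U, 0 < r p := fun p hp ↦ Real.sqrt_pos.2 (hBw_pos p hp)
    have hr_sq : ∀ p ∈ U, r p * r p = B p (w p) (w p) := fun p hp ↦
      Real.mul_self_sqrt (hBw_pos p hp).le
    have hr_sm : ContDiffOn ℝ ∞ r U := (hpair hwsm hwsm).sqrt fun p hp ↦ (hBw_pos p hp).ne'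
    -- `w` is `B`-orthogonal to the previous rows, on `U`
    have hwu : ∀ p ∈ U, ∀ l < i, B p (u l p) (w p) = 0 := by
      intro p hp l hl
      rw [hw]
      simp only [map_sub, map_sum, map_smul, smul_eq_mul]
      rw [Finset.sum_eq_single l (fun l' hl' hne ↦ by
          rw [horth p hp l hl l' (mem_range.1 hl'), if_neg (Ne.symm hne), mul_zero])
        (fun h ↦ absurd (mem_range.2 hl) h)]
      rw [horth p hp l hl l hl, if_pos rfl, mul_one, sub_self]
    have huw : ∀ p ∈ U, ∀ l < i, B p (w p) (u l p) = 0 := fun p hp l hl ↦ by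
      rw [hBs p hp, hwu p hp l hl]
    -- the new coefficient row
    set row : ℕ → P → ℝ := fun j p ↦
      ((if j = i then 1 else 0) - ∑ l ∈ range i, B p (u l p) (v i p) * c l j p) / r p with hrow
    have hrowsm : ∀ j, ContDiffOn ℝ ∞ (row j) U := fun j ↦
      (contDiffOn_const.sub (ContDiffOn.sum fun l _ ↦ (hpair (husm l) (hv i hi)).mul (hc l j))).div
        hr_sm fun p hp ↦ (hr_pos p hp).ne'
    -- the combination of the new row is `w / r`
    have hrow_comb : ∀ p, ∑ j ∈ range k, row j p • v j p = (r p)⁻¹ • w p := by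
      intro p
      have e1 : ∀ j ∈ range k, row j p • v j p =
          (r p)⁻¹ • ((if j = i then (1 : ℝ) else 0) • v j p -
            ∑ l ∈ range i, (B p (u l p) (v i p) * c l j p) • v j p) := by
        intro j _
        rw [hrow]
        simp only [div_eq_inv_mul, mul_smul, sub_smul, Finset.sum_smul]
      rw [Finset.sum_congr rfl e1, ← Finset.smul_sum, Finset.sum_sub_distrib]
      congr 1
      have e2 : ∑ j ∈ range k, (if j = i then (1 : ℝ) else 0) • v j p = v i p := by
        rw [Finset.sum_eq_single i (fun j _ hne ↦ by rw [if_neg hne, zero_smul])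
          (fun h ↦ absurd (mem_range.2 hi) h), if_pos rfl, one_smul]
      have e3 : ∑ j ∈ range k, ∑ l ∈ range i, (B p (u l p) (v i p) * c l j p) • v j p =
          ∑ l ∈ range i, B p (u l p) (v i p) • u l p := by
        rw [Finset.sum_comm]
        refine Finset.sum_congr rfl fun l _ ↦ ?_
        rw [hu]
        simp only [Finset.smul_sum, mul_smul]
      rw [e2, e3]
    -- the new coefficient matrix
    set c' : ℕ → ℕ → P → ℝ := fun l ↦ if l = i then row else c l with hc'
    have hc'old : ∀ l, l ≠ i → c' l = c l := fun l hl ↦ by simp [hc', hl]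
    have hc'new : c' i = row := by simp [hc']
    refine ⟨c', fun l j ↦ ?_, fun l j hlj ↦ ?_, fun l hl j ↦ ?_, fun p hp l hl ↦ ?_,
      fun p hp l hl l' hl' ↦ ?_⟩
    · -- smoothness
      by_cases hl : l = i
      · rw [hl, hc'new]; exact hrowsm j
      · rw [hc'old l hl]; exact hc l j
    · -- triangularity
      by_cases hl : l = i
      · subst hl
        rw [hc'new]
        funext p
        have h1 : (if j = l then (1 : ℝ) else 0) = 0 := if_neg (by omega)
        have h2 : ∑ l' ∈ range l, B p (u l' p) (v l p) * c l' j p = 0 :=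
          Finset.sum_eq_zero fun l' hl' ↦ by
            rw [htri l' j (by have := mem_range.1 hl'; omega)]; simp
        show row j p = 0
        rw [hrow]
        dsimp only
        rw [h1, h2, sub_zero, zero_div]
      · rw [hc'old l hl]; exact htri l j hlj
    · -- rows `≥ i + 1` vanish
      have hl' : l ≠ i := by omega
      rw [hc'old l hl']
      exact hzero l (by omega) j
    · -- positive diagonal
      by_cases hli' : l = i
      · subst hli'
        rw [hc'new, hrow]
        dsimp only
        have h2 : ∑ l' ∈ range l, B p (u l' p) (v l p) * c l' l p = 0 :=
          Finset.sum_eq_zero fun l' hl' ↦ by rw [htri l' l (mem_range.1 hl')]; simp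
        rw [if_pos rfl, h2, sub_zero]
        exact div_pos one_pos (hr_pos p hp)
      · rw [hc'old l hli']
        exact hdiag p hp l (by omega)
    · -- orthonormality of the `i + 1` rows
      have hcomb_old : ∀ l < i, ∑ j ∈ range k, c' l j p • v j p = u l p := fun l hl ↦ by
        rw [hc'old l (by omega)]
      have hcomb_new : ∑ j ∈ range k, c' i j p • v j p = (r p)⁻¹ • w p := by
        rw [hc'new]; exact hrow_comb p
      have hunit : B p ((r p)⁻¹ • w p) ((r p)⁻¹ • w p) = 1 := by
        rw [map_smul, map_smul]
        simp only [FunLike.coe_smul, Pi.smul_apply, smul_eq_mul]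
        rw [← hr_sq p hp]
        field_simp [(hr_pos p hp).ne']
      rcases Nat.lt_succ_iff_lt_or_eq.1 hl with hl₁ | hl₁ <;>
        rcases Nat.lt_succ_iff_lt_or_eq.1 hl' with hl₂ | hl₂
      · -- both old
        rw [hcomb_old _ hl₁, hcomb_old _ hl₂, horth p hp _ hl₁ _ hl₂]
      · -- `l` old, `l' = i`
        rw [hcomb_old _ hl₁, hl₂, hcomb_new, map_smul, smul_eq_mul, hwu p hp _ hl₁, mul_zero,
          if_neg (by omega)]
      · -- `l = i`, `l'` old
        rw [hcomb_old _ hl₂, hl₁, hcomb_new, map_smul]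
        simp only [FunLike.coe_smul, Pi.smul_apply, smul_eq_mul]
        rw [huw p hp _ hl₂, mul_zero, if_neg (by omega)]
      · -- both new
        rw [hl₁, hl₂, hcomb_new, hunit, if_pos rfl]

/-- **Smooth orthonormal frames for a varying positive definite form** (vector form of
`exists_smooth_gramSchmidt_coeff_bilin`): `k` fields `u l : P → V`, `C^∞` on `U`, pointwise
`B_p`-orthonormal, spanning pointwise the same flag as the `v j`. [cite: WarnerGTM94, 4.10, p. 149] -/
theorem exists_smooth_orthonormal_bilin {U : Set P} (B : P → V →L[ℝ] V →L[ℝ] ℝ)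
    (hB : ContDiffOn ℝ ∞ B U) (hBs : ∀ p ∈ U, ∀ x y, B p x y = B p y x)
    (hBpos : ∀ p ∈ U, ∀ x, x ≠ 0 → 0 < B p x x) (k : ℕ) (v : ℕ → P → V)
    (hv : ∀ j < k, ContDiffOn ℝ ∞ (v j) U)
    (hli : ∀ p ∈ U, LinearIndependent ℝ (fun j : Fin k => v j p)) :
    ∃ u : ℕ → P → V, (∀ l, ContDiffOn ℝ ∞ (u l) U) ∧
      ∀ p ∈ U, ∀ l < k, ∀ l' < k, B p (u l p) (u l' p) = if l = l' then 1 else 0 := by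
  obtain ⟨c, hc, -, -, horth⟩ := exists_smooth_gramSchmidt_coeff_bilin B hB hBs hBpos k v hv hli
  exact ⟨fun l p ↦ ∑ j ∈ range k, c l j p • v j p,
    fun l ↦ ContDiffOn.sum fun j hj ↦ (hc l j).smul (hv j (mem_range.1 hj)), horth⟩

/-- **Resolution of the identity in a `B`-orthonormal basis.** If `u₀, …, u_{k-1}` are
`B`-orthonormal (`B(u_l, u_{l'}) = δ`) in a space of dimension `k`, then every vector expands as
`x = ∑_l B(u_l, x) u_l`. [folklore] -/
theorem sum_bilin_smul_eq_self_of_orthonormal [FiniteDimensional ℝ V] (B : V →L[ℝ] V →L[ℝ] ℝ)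
    {k : ℕ} (hk : Module.finrank ℝ V = k) (u : Fin k → V)
    (horth : ∀ l l', B (u l) (u l') = if l = l' then 1 else 0) (x : V) :
    ∑ l, B (u l) x • u l = x := by
  classical
  -- `u` is linearly independent, hence a basis
  have hli : LinearIndependent ℝ u := by
    refine Fintype.linearIndependent_iff.2 fun g hg l ↦ ?_
    have h := congrArg (fun y ↦ B (u l) y) hg
    simp only [map_sum, map_smul, smul_eq_mul, map_zero, horth] at h
    simpa using h
  have hcard : Fintype.card (Fin k) = Module.finrank ℝ V := by simp [hk]
  let bu : Module.Basis (Fin k) ℝ V := basisOfLinearIndependentOfCardEqFinrank' u hli hcard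
  have hbu : ∀ l, bu l = u l := fun l ↦
    congrFun (coe_basisOfLinearIndependentOfCardEqFinrank' (K := ℝ) u hli hcard) l
  -- expand `x` in the basis and compare coefficients
  conv_rhs => rw [← bu.sum_repr x]
  refine Finset.sum_congr rfl fun l _ ↦ ?_
  rw [hbu]
  congr 1
  have hx := bu.sum_repr x
  have h := congrArg (fun y ↦ B (u l) y) hx.symm
  simp only [map_sum, map_smul, smul_eq_mul, hbu, horth] at h
  simpa [eq_comm] using h

end Literature.Analysis.InnerProduct
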